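import Summits.AtomisticToContinuum.Crystallization.Theorems.ThreeConeCertificateSlackRigidityPricedFloorsReadoff
import Summits.AtomisticToContinuum.Crystallization.Theorems.ThreeConeCertificateSlackRigidityPricedFloorsS3Defs
import Summits.AtomisticToContinuum.Crystallization.Theorems.ThreeConeCertificateSlackRigidityPricedFloorsProb
import Summits.AtomisticToContinuum.Crystallization.Theorems.PalmUnimodularRigidityMinimiserShellsEnergyFloorC
import HarnessLib

/-!
# `SlackRigidity` (stmt-AtomisticToContinuum-11960), line `priced-floors-palm-exactification`, stub S3
# (`stub_layeredMeanSelection`): final assembly, part 3a — energy pinning and readoff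

Lead c19.  Once almost every sample is a fitted rooted hard-core set whose stacking word alternates
(`lms_ae_faultfree`) and whose layer spacings are all equal (`lms_ae_equal_spacing`), every such
sample is a rotated `hcp(a, h)` crystal, so its root energy is `e(hcp a h) ≥ e*`
(`eStar_le_rootEnergy_of_faultfree`); with `E_P[h] ≤ e*` this pins `h = e*` almost surely, and
`lms_readoff` identifies the sample as an optimal hcp sample (`lms_optimal_of_ae`, registered: the
stub `stub_layeredMeanSelection` with the two almost-sure structural facts as hypotheses).
All `[folklore]`.
-/

noncomputable section

open MeasureTheory Filter Set
open scoped ENNReal BigOperators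

namespace Summit.AtomisticToContinuum.Crystallization.Theorems.SlackRigidityPricedFloorsFinal

open Literature.Probability.Process
open Literature.MathematicalPhysics.StatisticalMechanics
open Summit.AtomisticToContinuum.Crystallization.Theorems.SlackRigidityPricedFloors
open Summit.AtomisticToContinuum.Crystallization.Theorems.SlackRigidityPricedFloorsReadoff
open Summit.AtomisticToContinuum.Crystallization.Theorems.SlackRigidityPricedFloorsProb
open Summit.AtomisticToContinuum.Crystallization.Theorems.MinimiserShells.Negative.LoadBearing (eStar)
open Summit.AtomisticToContinuum.Crystallization.Theorems.PalmUnimodularRigidityMinimiserShells.EnergyFloor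
  (rootEnergy' measurable_rootEnergy' rootEnergy'_eq_of_hc rootEnergy'_bounds_of_hc)

/-- **A fault-free, equally spaced admissible layered set has root energy `≥ e*`** (it is a rotated
`hcp(a, h)`, whose root energy is `e(hcp a h)`, and `e* ≤ e(Q)` for every periodic `Q`). [folklore] -/
theorem eStar_le_rootEnergy_of_faultfree (A : E3 →ₗᵢ[ℝ] E3) (a h : ℝ) (s : ℤ → ℤ) (z : ℤ → ℝ)
    (hadm : IsAdmissibleLayering a s z) (hs : ∀ m : ℤ, s (m + 1) = -s m) (hz : ∀ m : ℤ, z m = m * h) :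
    eStar ≤ rootEnergy lennardJones ((Measure.count : Measure E3).restrict (layeredSet A a s z)) := by
  obtain ⟨ha0, _, hhs, hgap⟩ := hadm
  have h1 := hgap 0
  rw [zero_add, hz 1, hz 0] at h1
  push_cast at h1
  rw [one_mul, zero_mul, sub_zero] at h1
  have ha : a ≠ 0 := by intro h0; rw [h0] at ha0; norm_num at ha0
  have hh : h ≠ 0 := by intro h0; rw [h0] at h1; linarith [h1.1]
  set A' : E3 ≃ₗᵢ[ℝ] E3 := A.toLinearIsometryEquiv rfl with hA'
  have hcoe : (A' : E3 → E3) = A := LinearIsometry.coe_toLinearIsometryEquiv A rfl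
  have hL := haggLabel_eq_mul s hs
  have hge : eStar ≤ (hcpPeriodicConfiguration ha hh).energyPerParticle lennardJones :=
    ChargedEnergyGapNegative.eStar_le _
  rcases hhs 0 with h0 | h0
  · have hL' : ∀ m : ℤ, haggLabel s m = haggLabel alternatingHagg m := fun m => by
      rw [hL m, h0, one_mul]
    have hset : layeredSet A a s z = A' '' hcpStacking a h := by
      rw [layeredSet_eq_image A hL' hz, hcoe]
    rw [hset, rootEnergy_image_hcpStacking ha hh]
    exact hge
  · have hL' : ∀ m : ℤ, haggLabel s m = -haggLabel alternatingHagg m := fun m => by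
      rw [hL m, h0, neg_one_mul]
    have hset : layeredSet A a s z =
        ((LinearIsometryEquiv.neg ℝ).trans A') '' hcpStacking a h := by
      rw [layeredSet_eq_image_neg A hL' hz, LinearIsometryEquiv.coe_trans, hcoe,
        LinearIsometryEquiv.coe_neg]
      rfl
    rw [hset, rootEnergy_image_hcpStacking ha hh]
    exact hge

/-- **Energy pinning and readoff** (registered sub-goal `lms_optimal_of_ae`): under a minimising law,
if almost every sample is a fitted rooted `δ`-hard-core set, and on almost every such sample every
fitting datum has an alternating word and equally spaced layers, then almost every sample is an
optimal hcp sample. [folklore] -/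
theorem lms_optimal_of_ae : ∀ (δ : ℝ), 0 < δ → ∀ (P : Measure (Measure E3)), IsProbabilityMeasure P → IsMinimisingLaw δ P → (∀ᵐ μ ∂P, ∃ (S : Set E3) (e : LData), (0 : E3) ∈ S ∧ (∀ x ∈ S, ∀ y ∈ S, x ≠ y → δ ≤ dist x y) ∧ Fits S e ∧ μ = (Measure.count : Measure E3).restrict S) → (∀ᵐ μ ∂P, ∀ (S : Set E3) (e : LData), μ = (Measure.count : Measure E3).restrict S → (0 : E3) ∈ S → (∀ x ∈ S, ∀ y ∈ S, x ≠ y → δ ≤ dist x y) → Fits S e → ∀ m : ℤ, e.2.2.1 (m + 1) = -e.2.2.1 m) → (∀ᵐ μ ∂P, ∀ (S : Set E3) (e : LData), μ = (Measure.count : Measure E3).restrict S → (0 : E3) ∈ S → (∀ x ∈ S, ∀ y ∈ S, x ≠ y → δ ≤ dist x y) → Fits S e → ∀ m : ℤ, e.2.2.2 m = m * e.2.2.2 1) → ∀ᵐ μ ∂P, IsOptimalHcpSample μ := by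
  intro δ hδ P hP hlaw hfit hff heq
  obtain ⟨hcore, _, hE⟩ := hlaw
  -- a fitted sample, as a layered set
  have key : ∀ (S : Set E3) (e : LData), Fits S e →
      ∃ A : E3 →ₗᵢ[ℝ] E3, IsAdmissibleLayering e.2.1 e.2.2.1 e.2.2.2 ∧ e.2.2.2 0 = 0 ∧
        S = layeredSet A e.2.1 e.2.2.1 e.2.2.2 := by
    rintro S e ⟨⟨hT, hadm, hz0⟩, hS⟩
    exact ⟨frameIsometry e.1 hT, hadm, hz0, by rw [← hS, dataSet_eq_layeredSet e hT]⟩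
  -- pointwise: `e* ≤ h` almost surely
  have hge : ∀ᵐ μ ∂P, eStar ≤ rootEnergy lennardJones μ := by
    filter_upwards [hfit, hff, heq] with μ hμ hf hq
    obtain ⟨S, e, h0, hsep, he, rfl⟩ := hμ
    have hf' := hf S e rfl h0 hsep he
    have hq' := hq S e rfl h0 hsep he
    obtain ⟨A, hadm, -, hS⟩ := key S e he
    rw [hS]
    exact eStar_le_rootEnergy_of_faultfree A e.2.1 (e.2.2.2 1) e.2.2.1 e.2.2.2 hadm hf' hq'
  -- in mean `E[h] ≤ e*`, so `h = e*` almost surely (via the measurable version `rootEnergy'`)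
  have hHeq : ∀ᵐ μ ∂P, rootEnergy' μ = rootEnergy lennardJones μ := by
    filter_upwards [hcore] with μ hμ
    rw [rootEnergy'_eq_of_hc hδ hμ, rootEnergy_def]
  have hHb : ∀ᵐ μ ∂P, |rootEnergy' μ| ≤ 250 / 12 * δ⁻¹ ^ 6 + 250 / 24 * δ⁻¹ ^ 12 := by
    filter_upwards [hcore] with μ hμ
    obtain ⟨h1, h2⟩ := rootEnergy'_bounds_of_hc hδ hμ
    rw [abs_le]
    constructor <;> nlinarith [h1, h2, show (0 : ℝ) ≤ δ⁻¹ ^ 6 by positivity,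
      show (0 : ℝ) ≤ δ⁻¹ ^ 12 by positivity]
  have hint : Integrable rootEnergy' P := integrable_of_abs_le measurable_rootEnergy' hHb
  have hpin : ∀ᵐ μ ∂P, rootEnergy lennardJones μ = eStar := by
    have hnn : 0 ≤ᵐ[P] fun μ => rootEnergy' μ - eStar := by
      filter_upwards [hge, hHeq] with μ h1 h2
      show 0 ≤ rootEnergy' μ - eStar
      rw [h2]; linarith
    have hint' : Integrable (fun μ => rootEnergy' μ - eStar) P := hint.sub (integrable_const _)
    have hle : ∫ μ, (rootEnergy' μ - eStar) ∂P ≤ 0 := by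
      rw [integral_sub hint (integrable_const _), integral_const, smul_eq_mul, probReal_univ,
        one_mul, integral_congr_ae hHeq]
      linarith
    have h0 : ∫ μ, (rootEnergy' μ - eStar) ∂P = 0 := le_antisymm hle (integral_nonneg_of_ae hnn)
    have h5 := (integral_eq_zero_iff_of_nonneg_ae hnn hint').1 h0
    filter_upwards [h5, hHeq] with μ h1 h2
    have h1' : rootEnergy' μ - eStar = 0 := h1
    rw [← h2]; linarith
  -- readoff
  filter_upwards [hfit, hff, heq, hpin] with μ hμ hf hq hEμ
  obtain ⟨S, e, h0, hsep, he, rfl⟩ := hμ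
  have hf' := hf S e rfl h0 hsep he
  have hq' := hq S e rfl h0 hsep he
  obtain ⟨A, hadm, hz0, hS⟩ := key S e he
  rw [hS] at hEμ ⊢
  exact lms_readoff A e.2.1 (e.2.2.2 1) e.2.2.1 e.2.2.2 hadm hz0 hf' hq' hEμ.le

end Summit.AtomisticToContinuum.Crystallization.Theorems.SlackRigidityPricedFloorsFinal

end
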